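import Summits.CriticalPhenomena.Ising3DConformalLimit.Theorems.Interlacing.Negative.RegionCounterexample
import Literature.Probability.LatticeModels.IsingTransport
import Literature.Probability.LatticeModels.LatticeGraphProofs
import Literature.Probability.LatticeModels.GaussianPairingBoundCouplings

/-!
# `Interlacing` (item stmt-CriticalPhenomena-15702): the region-general form of box-SPC is false —
# stated for the tree's own finite-volume Ising expectations on `ℤ³`

The open stub of both lines of the crux (`Sketch.stub_engine` ⟺ `Birth.stub_cageScreening`) is, through
the landed identities, the statement that the FREE-boundary Ising model in the boxes `Λ_L ⊂ ℤ³` at `β_c`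
satisfies the interlacing inequality
`⟨σ_{x₁}σ_{x₂}σ_{x₃}σ_{x₄}⟩·⟨σ_{x₁}σ_{x₃}⟩⟨σ_{x₂}σ_{x₄}⟩ ≤ ⟨σ_{x₁}σ_{x₂}⟩⟨σ_{x₃}σ_{x₄}⟩·⟨σ_{x₁}σ_{x₄}⟩⟨σ_{x₂}σ_{x₃}⟩`
(`xₖ` the axis points `0, a e₁, (a+b) e₁, (a+b+c) e₁`) eventually in `L`. This file records, in exactly
that language (`isingExpect (zdGraph 3) Λ β 0 .free (spinMonomial …)`, `isingTwoPoint (zdGraph 3) Λ β 0 .free`),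
that the REGION-GENERAL version is false: `not_interlacing_freeRegion` — it fails for the finite volume
`Λ_Z = {0, e₁, 2e₁, 3e₁, e₂, e₁+e₂, 2e₁+e₂, e₁−e₂, 2e₁−e₂, 3e₁−e₂}` at `β = artanh (1/5)` and gaps
`(1,1,1)` (transport of `gksExpect_zRegion_interlacing_reversed` along the embedding `Fin 10 ↪ ℤ³`,
`isingCorr_free_map`). See `RegionCounterexample.lean` for the mechanism and the consequences.
THEOREM-ONLY.
-/

namespace Summit.CriticalPhenomena.Ising3DConformalLimit.InterlacingNegative

open Literature.Probability.LatticeModels Finset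

/-- **Whole-graph free Ising expectations as a pair ferromagnet with enumerated bonds.** If the edges of
the finite graph `G` are exactly the pairs `{u i, v i}` (`i : Fin m`, without repetition), then for every
observable `F`, `⟨F⟩^∅_{V;β,0} = ⟨F⟩_{V;K}` with `K ≡ β` on the `m` pair interactions
(Friedli–Velenik 2017, §3.8.1: `μ^∅_{Λ;β,0} = ν_{Λ;K}`). [cite: FriedliVelenik2017, §3.8.1] -/
theorem isingExpect_univ_free_eq_gksExpect_of_bonds {V : Type*} [Fintype V] [DecidableEq V]
    (G : SimpleGraph V) [DecidableRel G.Adj] {m : ℕ} (u v : Fin m → V)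
    (hE : ∀ e : Sym2 V, e ∈ G.edgeSet ↔ ∃ i, e = s(u i, v i))
    (hinj : Function.Injective fun i => (s(u i, v i) : Sym2 V))
    (huv : ∀ i, u i ≠ v i) (β : ℝ) (F : SpinConfig V → ℝ) :
    isingExpect G univ β 0 .free F =
      gksExpect univ (fun _ : Fin m => β) (fun i => ({u i, v i} : Finset V)) F := by
  have hEf : G.edgeFinset = univ.image fun i => (s(u i, v i) : Sym2 V) := by
    ext e
    rw [SimpleGraph.mem_edgeFinset, hE, Finset.mem_image]
    constructor
    · rintro ⟨i, rfl⟩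
      exact ⟨i, mem_univ _, rfl⟩
    · rintro ⟨i, -, rfl⟩
      exact ⟨i, rfl⟩
  have hH : ∀ σ : SpinConfig V, β * ∑ e ∈ G.edgeFinset, bondSpin σ e =
      gksHamiltonian univ (fun _ : Fin m => β) (fun i => ({u i, v i} : Finset V)) σ := by
    intro σ
    rw [gksHamiltonian, hEf, Finset.sum_image fun i _ j _ h => hinj h, Finset.mul_sum]
    refine Finset.sum_congr rfl fun i _ => ?_
    rw [bondSpin_mk, spinProduct, Finset.prod_pair (huv i)]
  rw [PairIsing.isingExpect_univ_free_eq_sum_div, gksExpect, gksSum, gksSum]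
  simp only [gksWeight, ← hH, one_mul]

/-- **The interlacing inequality is not region-general for free-boundary Ising on `ℤ³`.** It is FALSE
that for every finite volume `Λ ⊂ ℤ³` containing the axis segment `{0, …, (a+b+c)e₁}`, every `β > 0` and
all gaps `a, b, c ≥ 1`, the free-boundary finite-volume state `⟨·⟩^∅_{Λ;β,0}` satisfies
`S₄·(G₁₃G₂₄) ≤ G₁₂G₃₄·(G₁₄G₂₃)` at `x₁ = 0, x₂ = a e₁, x₃ = (a+b)e₁, x₄ = (a+b+c)e₁` (the shape of
`Sketch.stub_engine`'s conclusion with the box `Λ_L` replaced by an arbitrary region). Witness: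
`Λ = Λ_Z` (10 sites), `β = artanh (1/5)`, `(a,b,c) = (1,1,1)`, where the inequality is reversed strictly
(`gksExpect_zRegion_interlacing_reversed`). [folklore] -/
theorem not_interlacing_freeRegion :
    ¬ ∀ (Λ : Finset (Site 3)) (β : ℝ) (a b c : ℕ), 0 < β → 1 ≤ a → 1 ≤ b → 1 ≤ c →
        (∀ k : ℕ, k ≤ a + b + c → (Pi.single 0 (k : ℤ) : Site 3) ∈ Λ) →
        isingExpect (zdGraph 3) Λ β 0 .free
              (spinMonomial ![(Pi.single 0 ((0 : ℕ) : ℤ)), (Pi.single 0 ((a : ℕ) : ℤ)),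
                (Pi.single 0 ((a + b : ℕ) : ℤ)), (Pi.single 0 ((a + b + c : ℕ) : ℤ))]) *
            (isingTwoPoint (zdGraph 3) Λ β 0 .free (Pi.single 0 ((0 : ℕ) : ℤ)) (Pi.single 0 ((a + b : ℕ) : ℤ)) *
              isingTwoPoint (zdGraph 3) Λ β 0 .free (Pi.single 0 ((a : ℕ) : ℤ)) (Pi.single 0 ((a + b + c : ℕ) : ℤ))) ≤
          isingTwoPoint (zdGraph 3) Λ β 0 .free (Pi.single 0 ((0 : ℕ) : ℤ)) (Pi.single 0 ((a : ℕ) : ℤ)) *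
              isingTwoPoint (zdGraph 3) Λ β 0 .free (Pi.single 0 ((a + b : ℕ) : ℤ)) (Pi.single 0 ((a + b + c : ℕ) : ℤ)) *
            (isingTwoPoint (zdGraph 3) Λ β 0 .free (Pi.single 0 ((0 : ℕ) : ℤ)) (Pi.single 0 ((a + b + c : ℕ) : ℤ)) *
              isingTwoPoint (zdGraph 3) Λ β 0 .free (Pi.single 0 ((a : ℕ) : ℤ)) (Pi.single 0 ((a + b : ℕ) : ℤ))) := by
  intro h
  -- the ten sites of `Λ_Z`, as an embedding `Fin 10 ↪ ℤ³`
  obtain ⟨φ, hφ⟩ : ∃ φ : Fin 10 ↪ Site 3, (φ : Fin 10 → Site 3) =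
      (![![0, 0, 0], ![1, 0, 0], ![2, 0, 0], ![3, 0, 0], ![0, 1, 0], ![1, 1, 0], ![2, 1, 0],
        ![1, -1, 0], ![2, -1, 0], ![3, -1, 0]] : Fin 10 → Site 3) :=
    ⟨⟨_, by decide⟩, rfl⟩
  -- the axis segment `0, e₁, 2e₁, 3e₁` lies in `Λ_Z = univ.map φ`
  have hp0 : (Pi.single 0 ((0 : ℕ) : ℤ) : Site 3) = φ 0 := by rw [hφ]; decide
  have hp1 : (Pi.single 0 ((1 : ℕ) : ℤ) : Site 3) = φ 1 := by rw [hφ]; decide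
  have hp2 : (Pi.single 0 ((1 + 1 : ℕ) : ℤ) : Site 3) = φ 2 := by rw [hφ]; decide
  have hp3 : (Pi.single 0 ((1 + 1 + 1 : ℕ) : ℤ) : Site 3) = φ 3 := by rw [hφ]; decide
  have hmem : ∀ k : ℕ, k ≤ 1 + 1 + 1 → (Pi.single 0 (k : ℤ) : Site 3) ∈ (univ : Finset (Fin 10)).map φ := by
    intro k hk
    rw [Finset.mem_map]
    interval_cases k
    · exact ⟨0, mem_univ _, by rw [← hp0]⟩
    · exact ⟨1, mem_univ _, by rw [← hp1]⟩
    · exact ⟨2, mem_univ _, by rw [← hp2]⟩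
    · exact ⟨3, mem_univ _, by rw [← hp3]⟩
  have hle := h ((univ : Finset (Fin 10)).map φ) (Real.artanh (1 / 5)) 1 1 1 artanh_one_fifth_pos
    le_rfl le_rfl le_rfl hmem
  rw [hp0, hp1, hp2, hp3] at hle
  -- the induced graph on the ten sites: the 13 bonds `{uZ i, vZ i}`
  have huv : ∀ i : Fin 13, (![0, 1, 2, 4, 5, 7, 8, 0, 1, 2, 1, 2, 3] : Fin 13 → Fin 10) i ≠ (![1, 2, 3, 5, 6, 8, 9, 4, 5, 6, 7, 8, 9] : Fin 13 → Fin 10) i := by decide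
  have hinj : Function.Injective fun i : Fin 13 =>
      (s((![0, 1, 2, 4, 5, 7, 8, 0, 1, 2, 1, 2, 3] : Fin 13 → Fin 10) i, (![1, 2, 3, 5, 6, 8, 9, 4, 5, 6, 7, 8, 9] : Fin 13 → Fin 10) i) : Sym2 (Fin 10)) := by
    decide
  have hE : ∀ e : Sym2 (Fin 10), e ∈ (SimpleGraph.fromEdgeSet (Set.range fun i : Fin 13 => s((![0, 1, 2, 4, 5, 7, 8, 0, 1, 2, 1, 2, 3] : Fin 13 → Fin 10) i, (![1, 2, 3, 5, 6, 8, 9, 4, 5, 6, 7, 8, 9] : Fin 13 → Fin 10) i)) : SimpleGraph (Fin 10)).edgeSet ↔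
      ∃ i : Fin 13, e = s((![0, 1, 2, 4, 5, 7, 8, 0, 1, 2, 1, 2, 3] : Fin 13 → Fin 10) i, (![1, 2, 3, 5, 6, 8, 9, 4, 5, 6, 7, 8, 9] : Fin 13 → Fin 10) i) := by
    decide +kernel
  -- `φ` is a graph isomorphism onto the induced subgraph of `ℤ³`
  have hadj' : ∀ x y : Fin 10, (∑ i, |((![![0, 0, 0], ![1, 0, 0], ![2, 0, 0], ![3, 0, 0], ![0, 1, 0], ![1, 1, 0], ![2, 1, 0],
        ![1, -1, 0], ![2, -1, 0], ![3, -1, 0]] : Fin 10 → Site 3)) x i - ((![![0, 0, 0], ![1, 0, 0], ![2, 0, 0], ![3, 0, 0], ![0, 1, 0], ![1, 1, 0], ![2, 1, 0],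
        ![1, -1, 0], ![2, -1, 0], ![3, -1, 0]] : Fin 10 → Site 3)) y i| = 1) ↔ (SimpleGraph.fromEdgeSet (Set.range fun i : Fin 13 => s((![0, 1, 2, 4, 5, 7, 8, 0, 1, 2, 1, 2, 3] : Fin 13 → Fin 10) i, (![1, 2, 3, 5, 6, 8, 9, 4, 5, 6, 7, 8, 9] : Fin 13 → Fin 10) i)) : SimpleGraph (Fin 10)).Adj x y := by
    decide +kernel
  have hadj : ∀ x ∈ (univ : Finset (Fin 10)), ∀ y ∈ (univ : Finset (Fin 10)),
      ((zdGraph 3).Adj (φ x) (φ y) ↔ (SimpleGraph.fromEdgeSet (Set.range fun i : Fin 13 => s((![0, 1, 2, 4, 5, 7, 8, 0, 1, 2, 1, 2, 3] : Fin 13 → Fin 10) i, (![1, 2, 3, 5, 6, 8, 9, 4, 5, 6, 7, 8, 9] : Fin 13 → Fin 10) i)) : SimpleGraph (Fin 10)).Adj x y) := by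
    intro x _ y _
    rw [zdGraph_adj_iff_norm_holds, hφ]
    exact hadj' x y
  -- transport of the free finite-volume state along `φ`
  have hcorr : isingExpect (zdGraph 3) ((univ : Finset (Fin 10)).map φ) (Real.artanh (1 / 5)) 0 .free
        (spinProduct ((({0, 1, 2, 3} : Finset (Fin 10))).map φ)) =
      isingExpect (SimpleGraph.fromEdgeSet (Set.range fun i : Fin 13 => s((![0, 1, 2, 4, 5, 7, 8, 0, 1, 2, 1, 2, 3] : Fin 13 → Fin 10) i, (![1, 2, 3, 5, 6, 8, 9, 4, 5, 6, 7, 8, 9] : Fin 13 → Fin 10) i)) : SimpleGraph (Fin 10)) univ (Real.artanh (1 / 5)) 0 .free (spinProduct ({0, 1, 2, 3} : Finset (Fin 10))) :=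
    isingCorr_free_map (G := (SimpleGraph.fromEdgeSet (Set.range fun i : Fin 13 => s((![0, 1, 2, 4, 5, 7, 8, 0, 1, 2, 1, 2, 3] : Fin 13 → Fin 10) i, (![1, 2, 3, 5, 6, 8, 9, 4, 5, 6, 7, 8, 9] : Fin 13 → Fin 10) i)) : SimpleGraph (Fin 10))) (G' := zdGraph 3) φ hadj (Real.artanh (1 / 5)) 0 ({0, 1, 2, 3} : Finset (Fin 10))
  have h2pt : ∀ x y : Fin 10, isingTwoPoint (zdGraph 3) ((univ : Finset (Fin 10)).map φ) (Real.artanh (1 / 5)) 0 .free (φ x) (φ y) =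
      isingTwoPoint (SimpleGraph.fromEdgeSet (Set.range fun i : Fin 13 => s((![0, 1, 2, 4, 5, 7, 8, 0, 1, 2, 1, 2, 3] : Fin 13 → Fin 10) i, (![1, 2, 3, 5, 6, 8, 9, 4, 5, 6, 7, 8, 9] : Fin 13 → Fin 10) i)) : SimpleGraph (Fin 10)) univ (Real.artanh (1 / 5)) 0 .free x y := fun x y =>
    isingTwoPoint_free_map (G := (SimpleGraph.fromEdgeSet (Set.range fun i : Fin 13 => s((![0, 1, 2, 4, 5, 7, 8, 0, 1, 2, 1, 2, 3] : Fin 13 → Fin 10) i, (![1, 2, 3, 5, 6, 8, 9, 4, 5, 6, 7, 8, 9] : Fin 13 → Fin 10) i)) : SimpleGraph (Fin 10))) (G' := zdGraph 3) φ hadj (Real.artanh (1 / 5)) 0 x y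
  -- the four-point monomial is the spin product of the image of `{0,1,2,3}`
  have hmono : spinMonomial ![φ 0, φ 1, φ 2, φ 3] = spinProduct ((({0, 1, 2, 3} : Finset (Fin 10))).map φ) := by
    funext σ
    rw [spinMonomial, spinProduct, Finset.prod_map, Fin.prod_univ_four]
    rw [Finset.prod_insert (by decide), Finset.prod_insert (by decide), Finset.prod_insert (by decide),
      Finset.prod_singleton]
    simp only [Matrix.cons_val_zero, Matrix.cons_val_one, Matrix.head_cons, Matrix.cons_val_two,
      Matrix.tail_cons, Matrix.cons_val_three]
    ring
  rw [hmono, hcorr, h2pt 0 2, h2pt 1 3, h2pt 0 1, h2pt 2 3, h2pt 0 3, h2pt 1 2] at hle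
  -- the whole-graph free state on the ten sites is the pair ferromagnet `K ≡ artanh (1/5)`
  have hgks : ∀ F : SpinConfig (Fin 10) → ℝ, isingExpect (SimpleGraph.fromEdgeSet (Set.range fun i : Fin 13 => s((![0, 1, 2, 4, 5, 7, 8, 0, 1, 2, 1, 2, 3] : Fin 13 → Fin 10) i, (![1, 2, 3, 5, 6, 8, 9, 4, 5, 6, 7, 8, 9] : Fin 13 → Fin 10) i)) : SimpleGraph (Fin 10)) univ (Real.artanh (1 / 5)) 0 .free F =
      gksExpect univ (fun _ : Fin 13 => Real.artanh (1 / 5))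
        (fun i => ({(![0, 1, 2, 4, 5, 7, 8, 0, 1, 2, 1, 2, 3] : Fin 13 → Fin 10) i, (![1, 2, 3, 5, 6, 8, 9, 4, 5, 6, 7, 8, 9] : Fin 13 → Fin 10) i} : Finset (Fin 10))) F := fun F =>
    isingExpect_univ_free_eq_gksExpect_of_bonds _ _ _ hE hinj huv _ F
  simp only [isingTwoPoint, hgks] at hle
  exact absurd hle (not_le.mpr (gksExpect_zRegion_interlacing_reversed _ _ rfl rfl _ fun _ => rfl))

end Summit.CriticalPhenomena.Ising3DConformalLimit.InterlacingNegative
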